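import Literature.NumberTheory.LFunctions.YoshidaWindowGram
import Summits.RiemannHypothesis.RiemannHypothesis.Theorems.WeilFormatCEntryArchSeries
import Summits.Ventures.WeilGRH.ModulationCostConstants
import HarnessLib

/-!
# rh-explicit (venture WeilGRH): EXPLICIT BOUNDS FOR THE ARCHIMEDEAN INGREDIENTS OF YOSHIDA'S GRAM ENTRIES —
  `Re ψ`, `Re ψ′`, `Im ψ` on the quarter line and the window exponential sums

Cell `rh-explicit`, WEIL TRACK (structure seat weil-3, gen13).  Pure real analysis; RH-free.

Yoshida's matrix coefficients `(χ_n, χ_m)` of the Weil form on the window `[-a, a]` (1992, (5.15)/(5.16);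
`Literature…YoshidaWindowGram.gramCoeff`, identified with the tree's window form in `WeilFormatCEntrySesq`) carry,
at the frequency `ω = ω_n = πn/a`, the archimedean quantities `Re ψ(¼ + iω/2)`, `Re ψ′(¼ + iω/2)/(4a)`,
`Im ψ(¼ + iω/2)` and the exponential sums `Σ_k e^{−2a l_k}(…)` (`l_k = 2k + ½`).  This file bounds each of them
explicitly in `|ω|` (`|ω| ≥ 2`):

* `log_half_sub_le_reDigammaQuarter`: `log(|ω|/2) − 3/ω² ≤ Re ψ(¼ + iω/2)` (second-order Stirling from below; the
  upper side `≤ log(|ω|/2) + 2/ω²` is `ModulationCostConstants.reDigammaQuarter_le_log_half_add`);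
* `tsum_inv_nodeSq_add_sq_le`: `Σ_k 1/(l_k² + ω²) ≤ 2/|ω|` (finite split at `⌈|ω|/2⌉` + telescoping tail);
* `abs_re_deriv_digamma_quarter_le`: `|Re ψ′(¼ + iω/2)| ≤ 8/|ω|`;
* `abs_im_digamma_quarter_sub_le`: `|Im ψ(¼ + iω′/2) − Im ψ(¼ + iω/2)| ≤ 4|ω′ − ω|/|ω|` (`ωω′ ≥ 0`, `|ω| ≤ |ω′|`);
* `tsum_exp_neg_two_mul_digammaNode`: `Σ_k e^{−2a l_k} = e^{−a}/(1 − e^{−4a})`;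
* `abs_archExpSumDiag_le`, `abs_archExpSumSin_le`: the window sums are at most `4E(a)/(1 + 4ω²)` and
  `4E(a)|ω|/(1 + 4ω²)`, `E(a) = e^{−a}/(1 − e^{−4a})`.

Used by `YoshidaGramEntryBounds.lean` (two-sided bounds for the diagonal entries, absolute bounds for the
off-diagonal ones) and then by the explicit Beurling–Selberg window law `WeilSelbergWindowLaw.lean`.

No definitions, no named facts; RH-free.
-/

set_option autoImplicit false

noncomputable section

open Complex Filter Set Finset
open scoped Real Topology BigOperators

namespace Summit.Ventures.WeilGRH

open Literature.NumberTheory.LFunctions Literature.NumberTheory.LFunctions.Yoshida1992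
open Literature.Analysis.SpecialFunctions
open Summit.RiemannHypothesis.RiemannHypothesis.Theorems.WeilFormatC (hasSum_im_digamma_quarter
  hasSum_re_deriv_digamma_quarter summable_exp_neg_two_mul_digammaNode summable_sdiag summable_s0
  summable_one_div_digammaNode_sq)

/-! ## `Re ψ(¼ + iω/2)` from below -/

/-- **Second-order Stirling on the quarter line, lower side**: `log(|τ|/2) − 3/τ² ≤ Re ψ(¼ + iτ/2)` for
`|τ| ≥ 2` (`Re ψ(w) ≥ log‖w‖ − Re(1/2w) − 1/(6|Im w|³) − π/(12 Im w²)` at `w = ¼ + i|τ|/2`, `log‖w‖ ≥ log(|τ|/2)`,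
`Re(1/2w) = (1/2)/(¼+τ²) ≤ 1/(2τ²)`, `1/2 + 2/3 + π/3 ≤ 3`). -/
theorem log_half_sub_le_reDigammaQuarter {τ : ℝ} (hτ : 2 ≤ |τ|) :
    Real.log (|τ| / 2) - 3 / τ ^ 2 ≤ reDigammaQuarter τ := by
  set u : ℝ := |τ| with hu
  have hu2 : 2 ≤ u := hτ
  have hu0 : 0 < u := by linarith
  have hsq : τ ^ 2 = u ^ 2 := (sq_abs τ).symm
  have hRu : reDigammaQuarter τ = reDigammaQuarter u := by
    rcases abs_choice τ with h | h
    · rw [hu, h]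
    · rw [hu, h, reDigammaQuarter_even]
  rw [hRu, hsq]
  set w : ℂ := 1 / 4 + u / 2 * I with hw
  have hwre : w.re = 1 / 4 := by simp [hw]
  have hwim : w.im = u / 2 := by simp [hw]
  have hR : reDigammaQuarter u = (Complex.digamma w).re := rfl
  have hu2pos : (0 : ℝ) < u / 2 := by positivity
  have h1 := Literature.NumberTheory.LFunctions.Complex.abs_re_digamma_sub_log_norm_add_re_le
    (w := w) (by rw [hwre]; norm_num) (by rw [hwim]; exact hu2pos.ne')
  rw [hwim, abs_of_pos hu2pos] at h1
  have hinv : (1 / (2 * w)).re ≤ 1 / (2 * u ^ 2) := by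
    have h2w : (2 * w) = (1 / 2 : ℝ) + (u : ℝ) * I := by
      rw [hw]; push_cast; ring
    rw [h2w, one_div, Complex.inv_re, Complex.normSq_apply]
    simp only [Complex.add_re, Complex.ofReal_re, Complex.mul_re, Complex.I_re, Complex.ofReal_im,
      Complex.I_im, Complex.add_im, Complex.mul_im, mul_zero, sub_zero, add_zero, mul_one, zero_add]
    rw [div_le_div_iff₀ (by positivity) (by positivity)]
    nlinarith
  have hnorm_ge : u / 2 ≤ ‖w‖ := by
    have := Complex.abs_im_le_norm w
    rwa [hwim, abs_of_pos hu2pos] at this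
  have hlog_lo : Real.log (u / 2) ≤ Real.log ‖w‖ := Real.log_le_log hu2pos hnorm_ge
  have hpi := Real.pi_lt_d2
  have herr : 1 / (2 * u ^ 2) + (1 / (6 * (u / 2) ^ 3) + π / (12 * (u / 2) ^ 2)) ≤ 3 / u ^ 2 := by
    rw [show 1 / (6 * (u / 2) ^ 3) = 4 / (3 * u ^ 3) by field_simp; ring,
      show π / (12 * (u / 2) ^ 2) = π / 3 / u ^ 2 by field_simp; ring]
    have hu3 : 4 / (3 * u ^ 3) ≤ 2 / 3 / u ^ 2 := by
      rw [div_le_div_iff₀ (by positivity) (by positivity)]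
      nlinarith [pow_pos hu0 2]
    have hsum : 1 / (2 * u ^ 2) + (2 / 3 / u ^ 2 + π / 3 / u ^ 2) ≤ 3 / u ^ 2 := by
      rw [show 1 / (2 * u ^ 2) + (2 / 3 / u ^ 2 + π / 3 / u ^ 2) = (1 / 2 + 2 / 3 + π / 3) / u ^ 2 by
        field_simp; ring]
      exact div_le_div_of_nonneg_right (by linarith) (by positivity)
    linarith
  rw [hR]
  have := (abs_le.1 h1).1
  linarith

/-! ## The node sum `Σ_k 1/(l_k² + ω²)` -/

/-- `Σ_k 1/(l_k² + ω²)` converges (comparison with `Σ 1/l_k²`). -/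
theorem summable_inv_nodeSq_add_sq (ω : ℝ) : Summable (fun k : ℕ ↦ 1 / (digammaNode k ^ 2 + ω ^ 2)) := by
  refine Summable.of_nonneg_of_le (fun k ↦ by positivity) (fun k ↦ ?_) summable_one_div_digammaNode_sq
  have := digammaNode_pos k
  exact one_div_le_one_div_of_le (by positivity) (by nlinarith [sq_nonneg ω])

/-- Telescoping majorant of the node tail: `1/l_{j}² ≤ 1/(4j − 1) − 1/(4j + 3)` for `j ≥ 1`. -/
theorem inv_nodeSq_le_telescope {j : ℕ} (hj : 1 ≤ j) :
    1 / digammaNode j ^ 2 ≤ 1 / (4 * (j : ℝ) - 1) - 1 / (4 * (j : ℝ) + 3) := by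
  have hj' : (1 : ℝ) ≤ j := by exact_mod_cast hj
  have h1 : 0 < 4 * (j : ℝ) - 1 := by linarith
  have h2 : 0 < 4 * (j : ℝ) + 3 := by linarith
  rw [digammaNode, div_sub_div _ _ h1.ne' h2.ne', div_le_div_iff₀ (by positivity) (by positivity)]
  nlinarith

/-- **`Σ_k 1/(l_k² + ω²) ≤ 2/|ω|`** for `|ω| ≥ 2` (the first `⌈|ω|/2⌉` terms are `≤ 1/ω²` each, the tail telescopes
to `≤ 1/(2|ω| − 1)`). -/
theorem tsum_inv_nodeSq_add_sq_le {ω : ℝ} (hω : 2 ≤ |ω|) :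
    ∑' k : ℕ, 1 / (digammaNode k ^ 2 + ω ^ 2) ≤ 2 / |ω| := by
  have hω0 : 0 < |ω| := by linarith
  have hω2 : ω ^ 2 = |ω| ^ 2 := (sq_abs ω).symm
  set M : ℕ := ⌈|ω| / 2⌉₊ with hM
  have hMge : |ω| / 2 ≤ M := Nat.le_ceil _
  have hMle : (M : ℝ) ≤ |ω| / 2 + 1 := (Nat.ceil_lt_add_one (by positivity)).le
  have hM1 : 1 ≤ M := by
    have : (0 : ℝ) < M := by linarith
    exact_mod_cast this
  have hs := summable_inv_nodeSq_add_sq ω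
  rw [← Summable.sum_add_tsum_nat_add M hs]
  -- head
  have hhead : ∑ k ∈ Finset.range M, 1 / (digammaNode k ^ 2 + ω ^ 2) ≤ 1 / |ω| := by
    calc ∑ k ∈ Finset.range M, 1 / (digammaNode k ^ 2 + ω ^ 2)
        ≤ ∑ k ∈ Finset.range M, 1 / ω ^ 2 := Finset.sum_le_sum fun k _ ↦
          one_div_le_one_div_of_le (by rw [hω2]; positivity) (by nlinarith [sq_nonneg (digammaNode k)])
      _ = M * (1 / ω ^ 2) := by rw [Finset.sum_const, Finset.card_range, nsmul_eq_mul]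
      _ ≤ (|ω| / 2 + 1) * (1 / ω ^ 2) := mul_le_mul_of_nonneg_right hMle (by positivity)
      _ ≤ 1 / |ω| := by
          rw [hω2]
          rw [show (|ω| / 2 + 1) * (1 / |ω| ^ 2) = (|ω| / 2 + 1) / |ω| ^ 2 by ring,
            div_le_div_iff₀ (by positivity) hω0]
          nlinarith
  -- tail
  have htail : ∑' k : ℕ, 1 / (digammaNode (k + M) ^ 2 + ω ^ 2) ≤ 1 / |ω| := by
    have hs' : Summable (fun k : ℕ ↦ 1 / (digammaNode (k + M) ^ 2 + ω ^ 2)) :=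
      (summable_nat_add_iff M).2 hs
    have hbound : ∀ K : ℕ, ∑ k ∈ Finset.range K, 1 / (digammaNode (k + M) ^ 2 + ω ^ 2) ≤
        1 / (4 * (M : ℝ) - 1) := by
      intro K
      have hstep : ∀ k : ℕ, 1 / (digammaNode (k + M) ^ 2 + ω ^ 2) ≤
          1 / (4 * ((k + M : ℕ) : ℝ) - 1) - 1 / (4 * ((k + 1 + M : ℕ) : ℝ) - 1) := by
        intro k
        have hkM : 1 ≤ k + M := le_add_left hM1
        have h1 := inv_nodeSq_le_telescope hkM
        have h0 : 1 / (digammaNode (k + M) ^ 2 + ω ^ 2) ≤ 1 / digammaNode (k + M) ^ 2 :=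
          one_div_le_one_div_of_le (by have := digammaNode_pos (k + M); positivity) (by nlinarith [sq_nonneg ω])
        have e : 4 * ((k + 1 + M : ℕ) : ℝ) - 1 = 4 * ((k + M : ℕ) : ℝ) + 3 := by push_cast; ring
        rw [e]
        exact h0.trans h1
      have htel : ∀ K : ℕ, ∑ k ∈ Finset.range K,
          (1 / (4 * ((k + M : ℕ) : ℝ) - 1) - 1 / (4 * ((k + 1 + M : ℕ) : ℝ) - 1)) =
          1 / (4 * (M : ℝ) - 1) - 1 / (4 * ((K + M : ℕ) : ℝ) - 1) := by
        intro K
        induction K with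
        | zero => simp
        | succ K ih =>
          rw [Finset.sum_range_succ, ih]
          have e : ((K + 1 + M : ℕ) : ℝ) = ((K + M : ℕ) : ℝ) + 1 := by push_cast; ring
          rw [e]
          push_cast
          ring
      have hpos : 0 ≤ 1 / (4 * ((K + M : ℕ) : ℝ) - 1) := by
        have : (1 : ℝ) ≤ ((K + M : ℕ) : ℝ) := by exact_mod_cast le_add_left hM1
        exact div_nonneg zero_le_one (by linarith)
      calc ∑ k ∈ Finset.range K, 1 / (digammaNode (k + M) ^ 2 + ω ^ 2)
          ≤ ∑ k ∈ Finset.range K, (1 / (4 * ((k + M : ℕ) : ℝ) - 1) - 1 / (4 * ((k + 1 + M : ℕ) : ℝ) - 1)) :=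
            Finset.sum_le_sum fun k _ ↦ hstep k
        _ = 1 / (4 * (M : ℝ) - 1) - 1 / (4 * ((K + M : ℕ) : ℝ) - 1) := htel K
        _ ≤ 1 / (4 * (M : ℝ) - 1) := by linarith
    refine (hs'.tsum_le_of_sum_range_le hbound).trans ?_
    have h4M : |ω| ≤ 4 * (M : ℝ) - 1 := by linarith
    exact one_div_le_one_div_of_le hω0 h4M
  calc (∑ k ∈ Finset.range M, 1 / (digammaNode k ^ 2 + ω ^ 2)) +
        ∑' k : ℕ, 1 / (digammaNode (k + M) ^ 2 + ω ^ 2) ≤ 1 / |ω| + 1 / |ω| := add_le_add hhead htail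
    _ = 2 / |ω| := by ring

/-! ## `Re ψ′` and the increments of `Im ψ` on the quarter line -/

/-- **`|Re ψ′(¼ + iω/2)| ≤ 8/|ω|`** for `|ω| ≥ 2` (termwise `|4(l² − ω²)/(l² + ω²)²| ≤ 4/(l² + ω²)`). -/
theorem abs_re_deriv_digamma_quarter_le {ω : ℝ} (hω : 2 ≤ |ω|) :
    |(deriv Complex.digamma (1 / 4 + (ω : ℂ) / 2 * I)).re| ≤ 8 / |ω| := by
  have h := hasSum_re_deriv_digamma_quarter ω
  have hs := summable_inv_nodeSq_add_sq ω
  have hg : HasSum (fun k : ℕ ↦ 4 * (1 / (digammaNode k ^ 2 + ω ^ 2))) (4 * ∑' k : ℕ, 1 / (digammaNode k ^ 2 + ω ^ 2)) :=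
    hs.hasSum.mul_left 4
  have hterm : ∀ k : ℕ, |4 * (digammaNode k ^ 2 - ω ^ 2) / (digammaNode k ^ 2 + ω ^ 2) ^ 2| ≤
      4 * (1 / (digammaNode k ^ 2 + ω ^ 2)) := by
    intro k
    have hl := digammaNode_pos k
    have hpos : 0 < digammaNode k ^ 2 + ω ^ 2 := by positivity
    rw [abs_div, abs_of_pos (by positivity : 0 < (digammaNode k ^ 2 + ω ^ 2) ^ 2), div_le_iff₀ (by positivity)]
    rw [abs_mul, abs_of_pos (by norm_num : (0 : ℝ) < 4)]
    have h1 : |digammaNode k ^ 2 - ω ^ 2| ≤ digammaNode k ^ 2 + ω ^ 2 := by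
      rw [abs_le]; constructor <;> nlinarith [sq_nonneg ω, sq_nonneg (digammaNode k)]
    calc 4 * |digammaNode k ^ 2 - ω ^ 2| ≤ 4 * (digammaNode k ^ 2 + ω ^ 2) := by linarith
      _ = 4 * (1 / (digammaNode k ^ 2 + ω ^ 2)) * (digammaNode k ^ 2 + ω ^ 2) ^ 2 := by field_simp
  have hup : (deriv Complex.digamma (1 / 4 + (ω : ℂ) / 2 * I)).re ≤ 4 * ∑' k : ℕ, 1 / (digammaNode k ^ 2 + ω ^ 2) :=
    hasSum_le (fun k ↦ (le_abs_self _).trans (hterm k)) h hg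
  have hlo : -(4 * ∑' k : ℕ, 1 / (digammaNode k ^ 2 + ω ^ 2)) ≤ (deriv Complex.digamma (1 / 4 + (ω : ℂ) / 2 * I)).re := by
    have h' := hasSum_le (fun k ↦ (neg_abs_le _).trans' (neg_le_neg (hterm k))) hg.neg h
    linarith
  have hT := tsum_inv_nodeSq_add_sq_le hω
  have h8 : 4 * ∑' k : ℕ, 1 / (digammaNode k ^ 2 + ω ^ 2) ≤ 8 / |ω| :=
    calc 4 * ∑' k : ℕ, 1 / (digammaNode k ^ 2 + ω ^ 2) ≤ 4 * (2 / |ω|) := mul_le_mul_of_nonneg_left hT (by norm_num)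
      _ = 8 / |ω| := by ring
  rw [abs_le]
  constructor <;> linarith

/-- Termwise: `|2ω′/(l² + ω′²) − 2ω/(l² + ω²)| ≤ 2|ω′ − ω|/(l² + ω²)` when `ωω′ ≥ 0` and `|ω| ≤ |ω′|`. -/
theorem abs_im_term_sub_le {l ω ω' : ℝ} (hl : 0 < l) (hs : 0 ≤ ω * ω') (hle : |ω| ≤ |ω'|) :
    |2 * ω' / (l ^ 2 + ω' ^ 2) - 2 * ω / (l ^ 2 + ω ^ 2)| ≤ 2 * |ω' - ω| / (l ^ 2 + ω ^ 2) := by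
  have hp : 0 < l ^ 2 + ω ^ 2 := by positivity
  have hp' : 0 < l ^ 2 + ω' ^ 2 := by positivity
  have hkey : 2 * ω' / (l ^ 2 + ω' ^ 2) - 2 * ω / (l ^ 2 + ω ^ 2) =
      2 * (ω' - ω) * (l ^ 2 - ω * ω') / ((l ^ 2 + ω' ^ 2) * (l ^ 2 + ω ^ 2)) := by
    field_simp; ring
  rw [hkey, abs_div, abs_of_pos (by positivity : 0 < (l ^ 2 + ω' ^ 2) * (l ^ 2 + ω ^ 2)), abs_mul, abs_mul,
    abs_of_pos (by norm_num : (0 : ℝ) < 2), div_le_div_iff₀ (by positivity) hp]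
  have hsq : ω * ω' ≤ ω' ^ 2 := by
    have h1 : |ω| * |ω'| ≤ |ω'| * |ω'| := mul_le_mul_of_nonneg_right hle (abs_nonneg _)
    rw [← abs_mul, ← abs_mul] at h1
    rw [← abs_of_nonneg hs]
    calc |ω * ω'| ≤ |ω' * ω'| := h1
      _ = ω' ^ 2 := by rw [abs_mul_self, sq]
  have h2 : |l ^ 2 - ω * ω'| ≤ l ^ 2 + ω' ^ 2 := by
    rw [abs_le]; constructor <;> nlinarith
  calc 2 * |ω' - ω| * |l ^ 2 - ω * ω'| * (l ^ 2 + ω ^ 2)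
      ≤ 2 * |ω' - ω| * (l ^ 2 + ω' ^ 2) * (l ^ 2 + ω ^ 2) := by gcongr
    _ = 2 * |ω' - ω| * ((l ^ 2 + ω' ^ 2) * (l ^ 2 + ω ^ 2)) := by ring

/-- **`|Im ψ(¼ + iω′/2) − Im ψ(¼ + iω/2)| ≤ 4|ω′ − ω|/|ω|`** for `ωω′ ≥ 0`, `2 ≤ |ω| ≤ |ω′|`. -/
theorem abs_im_digamma_quarter_sub_le {ω ω' : ℝ} (hω : 2 ≤ |ω|) (hs : 0 ≤ ω * ω') (hle : |ω| ≤ |ω'|) :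
    |(Complex.digamma (1 / 4 + (ω' : ℂ) / 2 * I)).im - (Complex.digamma (1 / 4 + (ω : ℂ) / 2 * I)).im| ≤
      4 * |ω' - ω| / |ω| := by
  have h := (hasSum_im_digamma_quarter ω').sub (hasSum_im_digamma_quarter ω)
  have hsum := summable_inv_nodeSq_add_sq ω
  have hg : HasSum (fun k : ℕ ↦ 2 * |ω' - ω| * (1 / (digammaNode k ^ 2 + ω ^ 2)))
      (2 * |ω' - ω| * ∑' k : ℕ, 1 / (digammaNode k ^ 2 + ω ^ 2)) := hsum.hasSum.mul_left _
  have hterm : ∀ k : ℕ, |2 * ω' / (digammaNode k ^ 2 + ω' ^ 2) - 2 * ω / (digammaNode k ^ 2 + ω ^ 2)| ≤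
      2 * |ω' - ω| * (1 / (digammaNode k ^ 2 + ω ^ 2)) := by
    intro k
    have := abs_im_term_sub_le (digammaNode_pos k) hs hle
    rw [mul_one_div]
    exact this
  have hup := hasSum_le (fun k ↦ (le_abs_self _).trans (hterm k)) h hg
  have hlo : -(2 * |ω' - ω| * ∑' k : ℕ, 1 / (digammaNode k ^ 2 + ω ^ 2)) ≤
      (Complex.digamma (1 / 4 + (ω' : ℂ) / 2 * I)).im - (Complex.digamma (1 / 4 + (ω : ℂ) / 2 * I)).im := by
    have h' := hasSum_le (fun k ↦ (neg_abs_le _).trans' (neg_le_neg (hterm k))) hg.neg h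
    linarith
  have hT := tsum_inv_nodeSq_add_sq_le hω
  have hω0 : 0 < |ω| := by linarith
  have hD : 0 ≤ |ω' - ω| := abs_nonneg _
  have hkey : 2 * |ω' - ω| * ∑' k : ℕ, 1 / (digammaNode k ^ 2 + ω ^ 2) ≤ 4 * |ω' - ω| / |ω| := by
    calc 2 * |ω' - ω| * ∑' k : ℕ, 1 / (digammaNode k ^ 2 + ω ^ 2) ≤ 2 * |ω' - ω| * (2 / |ω|) :=
          mul_le_mul_of_nonneg_left hT (by positivity)
      _ = 4 * |ω' - ω| / |ω| := by ring
  rw [abs_le]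
  constructor <;> linarith

/-! ## The window exponential sums -/

/-- **`Σ_k e^{−2a l_k} = e^{−a}/(1 − e^{−4a})`** (`a > 0`; geometric with ratio `e^{−4a}`). -/
theorem tsum_exp_neg_two_mul_digammaNode {a : ℝ} (ha : 0 < a) :
    ∑' k : ℕ, Real.exp (-(2 * a * digammaNode k)) = Real.exp (-a) / (1 - Real.exp (-(4 * a))) := by
  have hq0 : 0 ≤ Real.exp (-(4 * a)) := (Real.exp_pos _).le
  have hq1 : Real.exp (-(4 * a)) < 1 := Real.exp_lt_one_iff.2 (by linarith)
  have hterm : ∀ k : ℕ, Real.exp (-(2 * a * digammaNode k)) = Real.exp (-a) * Real.exp (-(4 * a)) ^ k := by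
    intro k
    rw [digammaNode, ← Real.exp_nat_mul, ← Real.exp_add]
    congr 1; ring
  simp_rw [hterm]
  rw [tsum_mul_left, tsum_geometric_of_lt_one hq0 hq1, div_eq_mul_inv]

/-- `E(a) = e^{−a}/(1 − e^{−4a})` is positive. -/
theorem expSumConst_pos {a : ℝ} (ha : 0 < a) : 0 < Real.exp (-a) / (1 - Real.exp (-(4 * a))) :=
  div_pos (Real.exp_pos _) (by have := Real.exp_lt_one_iff.2 (show -(4 * a) < 0 by linarith); linarith)

/-- **`|archExpSumDiag a n| ≤ 4E(a)/(1 + 4ω_n²)`**. -/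
theorem abs_archExpSumDiag_le {a : ℝ} (ha : 0 < a) (n : ℤ) :
    |archExpSumDiag a n| ≤ 4 * (Real.exp (-a) / (1 - Real.exp (-(4 * a)))) / (1 + 4 * freq a n ^ 2) := by
  set ω := freq a n
  have hsum := summable_sdiag ha ω
  have hE := (summable_exp_neg_two_mul_digammaNode ha)
  have hterm : ∀ k : ℕ, |Real.exp (-(2 * a * digammaNode k)) *
      ((digammaNode k ^ 2 - ω ^ 2) / (digammaNode k ^ 2 + ω ^ 2) ^ 2)| ≤
      Real.exp (-(2 * a * digammaNode k)) * (4 / (1 + 4 * ω ^ 2)) := by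
    intro k
    have hl := one_half_le_digammaNode k
    have hpos : 0 < digammaNode k ^ 2 + ω ^ 2 := by have := digammaNode_pos k; positivity
    rw [abs_mul, abs_of_pos (Real.exp_pos _)]
    refine mul_le_mul_of_nonneg_left ?_ (Real.exp_pos _).le
    rw [abs_div, abs_of_pos (by positivity : 0 < (digammaNode k ^ 2 + ω ^ 2) ^ 2),
      div_le_div_iff₀ (by positivity) (by positivity)]
    have h1 : |digammaNode k ^ 2 - ω ^ 2| ≤ digammaNode k ^ 2 + ω ^ 2 := by
      rw [abs_le]; constructor <;> nlinarith [sq_nonneg ω, sq_nonneg (digammaNode k)]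
    have h2 : 1 + 4 * ω ^ 2 ≤ 4 * (digammaNode k ^ 2 + ω ^ 2) := by nlinarith
    calc |digammaNode k ^ 2 - ω ^ 2| * (1 + 4 * ω ^ 2) ≤ (digammaNode k ^ 2 + ω ^ 2) * (4 * (digammaNode k ^ 2 + ω ^ 2)) :=
          mul_le_mul h1 h2 (by positivity) hpos.le
      _ = 4 * (digammaNode k ^ 2 + ω ^ 2) ^ 2 := by ring
  unfold archExpSumDiag
  calc |∑' k : ℕ, Real.exp (-(2 * a * digammaNode k)) * ((digammaNode k ^ 2 - ω ^ 2) / (digammaNode k ^ 2 + ω ^ 2) ^ 2)|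
      ≤ ∑' k : ℕ, |Real.exp (-(2 * a * digammaNode k)) * ((digammaNode k ^ 2 - ω ^ 2) / (digammaNode k ^ 2 + ω ^ 2) ^ 2)| := by
        have := norm_tsum_le_tsum_norm hsum.norm
        simpa only [Real.norm_eq_abs] using this
    _ ≤ ∑' k : ℕ, Real.exp (-(2 * a * digammaNode k)) * (4 / (1 + 4 * ω ^ 2)) :=
        Summable.tsum_le_tsum hterm hsum.abs (hE.mul_right _)
    _ = 4 * (Real.exp (-a) / (1 - Real.exp (-(4 * a)))) / (1 + 4 * ω ^ 2) := by
        rw [tsum_mul_right, tsum_exp_neg_two_mul_digammaNode ha]; ring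

/-- **`|archExpSumSin a n| ≤ 4E(a)|ω_n|/(1 + 4ω_n²)`**. -/
theorem abs_archExpSumSin_le {a : ℝ} (ha : 0 < a) (n : ℤ) :
    |archExpSumSin a n| ≤ 4 * (Real.exp (-a) / (1 - Real.exp (-(4 * a)))) * |freq a n| / (1 + 4 * freq a n ^ 2) := by
  set ω := freq a n
  have hsum := summable_s0 ha ω
  have hE := (summable_exp_neg_two_mul_digammaNode ha)
  have hterm : ∀ k : ℕ, |Real.exp (-(2 * a * digammaNode k)) * (ω / (digammaNode k ^ 2 + ω ^ 2))| ≤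
      Real.exp (-(2 * a * digammaNode k)) * (4 * |ω| / (1 + 4 * ω ^ 2)) := by
    intro k
    have hl := one_half_le_digammaNode k
    have hpos : 0 < digammaNode k ^ 2 + ω ^ 2 := by have := digammaNode_pos k; positivity
    rw [abs_mul, abs_of_pos (Real.exp_pos _)]
    refine mul_le_mul_of_nonneg_left ?_ (Real.exp_pos _).le
    rw [abs_div, abs_of_pos hpos, div_le_div_iff₀ hpos (by positivity)]
    have h2 : 1 + 4 * ω ^ 2 ≤ 4 * (digammaNode k ^ 2 + ω ^ 2) := by nlinarith
    calc |ω| * (1 + 4 * ω ^ 2) ≤ |ω| * (4 * (digammaNode k ^ 2 + ω ^ 2)) :=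
          mul_le_mul_of_nonneg_left h2 (abs_nonneg _)
      _ = 4 * |ω| * (digammaNode k ^ 2 + ω ^ 2) := by ring
  unfold archExpSumSin
  calc |∑' k : ℕ, Real.exp (-(2 * a * digammaNode k)) * (ω / (digammaNode k ^ 2 + ω ^ 2))|
      ≤ ∑' k : ℕ, |Real.exp (-(2 * a * digammaNode k)) * (ω / (digammaNode k ^ 2 + ω ^ 2))| := by
        have := norm_tsum_le_tsum_norm hsum.norm
        simpa only [Real.norm_eq_abs] using this
    _ ≤ ∑' k : ℕ, Real.exp (-(2 * a * digammaNode k)) * (4 * |ω| / (1 + 4 * ω ^ 2)) :=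
        Summable.tsum_le_tsum hterm hsum.abs (hE.mul_right _)
    _ = 4 * (Real.exp (-a) / (1 - Real.exp (-(4 * a)))) * |ω| / (1 + 4 * ω ^ 2) := by
        rw [tsum_mul_right, tsum_exp_neg_two_mul_digammaNode ha]; ring

end Summit.Ventures.WeilGRH

end
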